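import Mathlib
import HarnessLib
import Literature.Analysis.FluidPDE.LocalTypeICharacterizationHolds
import Literature.Analysis.FluidPDE.LocalTypeIBlowup.Engine
import Literature.Analysis.FluidPDE.LocalTypeIBlowup.Approximants
import Literature.Analysis.FluidPDE.LocalTypeIBlowup.Limits
import Literature.Analysis.FluidPDE.LocalTypeIBlowup.Nontrivial
import Literature.Analysis.FluidPDE.LocalTypeIBlowup.Mild

/-!
# Blow-up at a local Type I singular point (Albritton–Barker 2019, Thm. 1.1, forward direction;
# Seregin–Šverák 2009, Thm. 2.8): assembly — `AlbrittonBarkerForward_holds`, `AlbrittonBarkerTypeICharacterization_holds`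

Analysis/FluidPDE proof file (theorems only: no definition, no named fact, no `sorry`).  PORT NOTE: this
module is the Literature twin of the Summits-side file
`Summits/NavierStokesRegularity/NavierStokesRegularity/Theorems/HardyPointSinkABForwardHardy.lean` (prover
seats of route HardyPointSink, landed 2026-08-16, kernel-checked), carried over verbatim up to the namespace
(`Literature.Analysis.FluidPDE.LocalTypeIBlowup`, topic-aligned) and the provenance tags, so that the Literature named
facts `Literature.Analysis.FluidPDE.AlbrittonBarkerForward` (`LocalTypeICharacterization.lean`) and
`Literature.Analysis.FluidPDE.AlbrittonBarkerTypeICharacterization` (`LocalTypeI.lean`) are discharged INSIDE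
`Literature/` (`AlbrittonBarkerForwardHolds.lean`), where `LocalTypeICharacterizationHolds.lean` asks for them; the
Summits copies are the dedup candidates of record (librarian pattern (b), promote request filed 2026-08-26).
The mathematics is the published blow-up procedure at a local Type I singular point (Seregin–Šverák 2009, §2 and
Thm. 2.8; Albritton–Barker 2019, Prop. 2.4 and §3); nothing here is a claim about Navier–Stokes regularity.

**Albritton–Barker 2019, Thm. 1.1, forward direction** ("there exists a suitable weak solution with Type I
singular point ⇒ there exists a non-trivial mild bounded ancient solution with `𝐈 < ∞`"; A–B §3: "essentially
known", by Prop. 2.4 and the rescaling procedure of Seregin–Šverák 2009, Thm. 2.8).  The main theorem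
`LocalTypeIBlowup.exists_ancientMild_of_localTypeISingularPoint`: a local Type I singular point
(`IsLocalTypeISingularPoint r₀ z u p`: a suitable weak solution `(u, p)` in a parabolic ball `Q(z, r₀)` whose vertex
is backward singular, with `𝐈(Q(z, r₀)) < ∞`) yields a non-trivial mild bounded ancient solution (`ν = 1`) with
measurable slices, suitable on `(EuclideanSpace ℝ (Fin 3)) × ℝ₋` with a pressure and a weak gradient and `𝐈 < ∞`
(the Summits twin additionally carries a route-specific weighted-`L²` clause, dropped here together with its helper
file `…HardyScaling`).  `AlbrittonBarkerForward_holds` repackages it as the named fact and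
`AlbrittonBarkerTypeICharacterization_holds` is the one-line composite with `AlbrittonBarkerTypeICharacterization_of_forward`.
Proof (A–B §3 / Seregin–Šverák 2009, Thm. 2.8, with the point-picking and compactness organisation of the helper
files):

1. rescale `Q(z, r₀)` to the unit ball (the class, the weak gradient, `𝐈` and the backward
   singularity are scale invariant);
2. the blow-up sequence of file `…Approximants` (clean vertex, point picking, zooms bounded by
   `1` on `Q(0, 2^{k+1})` with `‖v_k(0,0)‖ = 1/2`);
3. the slab limit `(U, P, H)` of file `…Engine` (`𝐈 ≤ 4 𝐈(Q(z, r₀))`, strong `L³_loc`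
   convergence), bounded by `1` a.e. (file `…Limits`), truncated to a pointwise bound;
4. the continuous Oseen-mild representative of file `…Mild`, a mild bounded ancient solution
   with measurable slices; non-trivial by the uniform `L³` mass of file `…Nontrivial`.

## References

* D. Albritton, T. Barker, J. Math. Fluid Mech. 21 (2019) = arXiv:1811.00502, Thm. 1.1, §3.
* G. Seregin, V. Šverák, Comm. PDE 34 (2009) = arXiv:0804.1803, §2, Thm. 2.8.
* G. Koch, N. Nadirashvili, G. Seregin, V. Šverák, Acta Math. 203 (2009), §6.
-/

noncomputable section

open MeasureTheory Set Function Filter Topology TopologicalSpace Metric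
open scoped NNReal ENNReal
open Literature.Analysis Literature.Analysis.FluidPDE

namespace Literature.Analysis.FluidPDE

open LocalTypeIBlowup

/-- The backward slab is exhausted by the balls `Q(0, n+1)`. [folklore] -/
private theorem LocalTypeIBlowup.lowerHalf_subset_iUnion :
    (Iio (0 : ℝ) ×ˢ (univ : Set (EuclideanSpace ℝ (Fin 3)))) ⊆ ⋃ n : ℕ, parabolicCylinder ((n : ℝ) + 1) (0 : ℝ × (EuclideanSpace ℝ (Fin 3))) := by
  rintro ⟨t, x⟩ ⟨ht, -⟩
  obtain ⟨n, hn⟩ := exists_nat_ge (‖x‖ - t)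
  refine mem_iUnion.2 ⟨n, ?_⟩
  rw [mem_parabolicCylinder]
  simp only [Prod.fst_zero, Prod.snd_zero, zero_sub, dist_zero_right]
  have ht' : t < 0 := ht
  have hx : 0 ≤ ‖x‖ := norm_nonneg x
  refine ⟨⟨?_, ht'⟩, by linarith⟩
  nlinarith

/-- **The blow-up of a local Type I singular point** (Albritton–Barker 2019, Thm. 1.1, forward
direction; Seregin–Šverák 2009, Thm. 2.8; module docstring).  From a local Type I singular point
(`IsLocalTypeISingularPoint r₀ z u p`) we obtain a mild bounded ancient solution `V` (`ν = 1`) with continuous,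
hence measurable, slices, a pressure `P` and a weak gradient `H` making it suitable on
`(EuclideanSpace ℝ (Fin 3)) × ℝ₋`, non-trivial, with `𝐈 < ∞`.
[cite: AlbrittonBarker2019, Thm 1.1 (forward direction) and §3; SereginSverak2009, Thm 2.8] -/
theorem LocalTypeIBlowup.exists_ancientMild_of_localTypeISingularPoint {r₀ : ℝ} {z : ℝ × (EuclideanSpace ℝ (Fin 3))}
    {u : ℝ → (EuclideanSpace ℝ (Fin 3)) → (EuclideanSpace ℝ (Fin 3))} {p : ℝ → (EuclideanSpace ℝ (Fin 3)) → ℝ} (hloc : IsLocalTypeISingularPoint r₀ z u p) :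
    ∃ (V : ℝ → (EuclideanSpace ℝ (Fin 3)) → (EuclideanSpace ℝ (Fin 3))) (P : ℝ → (EuclideanSpace ℝ (Fin 3)) → ℝ) (H : ℝ → (EuclideanSpace ℝ (Fin 3)) → (EuclideanSpace ℝ (Fin 3)) →L[ℝ] (EuclideanSpace ℝ (Fin 3))),
      (∀ t < 0, AEStronglyMeasurable (V t) volume) ∧
      IsBoundedAncientMildSolution 1 V ∧
      IsSuitableWeakSolutionOn (slab (EuclideanSpace ℝ (Fin 3)) (Iio 0) isOpen_Iio) 1 0 V P ∧
      HasWeakSpatialGradientOn (slab (EuclideanSpace ℝ (Fin 3)) (Iio 0) isOpen_Iio) V H ∧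
      ¬ (uncurry V =ᵐ[volume.restrict (Iio (0 : ℝ) ×ˢ (univ : Set (EuclideanSpace ℝ (Fin 3))))] 0) ∧
      typeIBound (Iio (0 : ℝ) ×ˢ (univ : Set (EuclideanSpace ℝ (Fin 3)))) V P H < ⊤ := by
  obtain ⟨hr₀, hball, hsing, G, hwg, hI⟩ := hloc
  -- ## Step 1: rescale to the unit ball
  set u₁ : ℝ → (EuclideanSpace ℝ (Fin 3)) → (EuclideanSpace ℝ (Fin 3)) := r₀ • stPull (r₀ ^ 2) r₀ z.1 z.2 u with hu₁
  set p₁ : ℝ → (EuclideanSpace ℝ (Fin 3)) → ℝ := r₀ ^ 2 • stPull (r₀ ^ 2) r₀ z.1 z.2 p with hp₁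
  set G₁ : ℝ → (EuclideanSpace ℝ (Fin 3)) → (EuclideanSpace ℝ (Fin 3)) →L[ℝ] (EuclideanSpace ℝ (Fin 3)) := r₀ ^ 2 • stPull (r₀ ^ 2) r₀ z.1 z.2 G with hG₁
  have hball1 : IsSuitableWeakSolutionInBall 1 (0 : ℝ × (EuclideanSpace ℝ (Fin 3))) u₁ p₁ := hball.zoom hr₀
  have hwg1 : HasWeakSpatialGradientOn (parabolicCylinderOpens 1 (0 : ℝ × (EuclideanSpace ℝ (Fin 3)))) u₁ G₁ := by
    have h := hwg.stRescale r₀ (β := r₀ ^ 2) (γ := r₀) (pow_pos hr₀ 2) hr₀ z.1 z.2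
    rw [zoom_stPreimage_parabolicCylinderOpens hr₀ z, show r₀ * r₀ = r₀ ^ 2 by ring] at h
    exact h
  have hI1 : typeIBound (parabolicCylinder 1 (0 : ℝ × (EuclideanSpace ℝ (Fin 3)))) u₁ p₁ G₁ =
      typeIBound (parabolicCylinder r₀ z) u p G := by
    rw [← zoom_preimage_parabolicCylinder_self hr₀ z]
    exact typeIBound_nsZoom hr₀ z.1 z.2 _ u p G
  have hst0 : stAffine (r₀ ^ 2) r₀ z.1 z.2 0 = z := by
    rw [show (0 : ℝ × (EuclideanSpace ℝ (Fin 3))) = ((0 : ℝ), (0 : (EuclideanSpace ℝ (Fin 3)))) from rfl, stAffine_apply, mul_zero, add_zero,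
      smul_zero, add_zero]
  have hsing1 : IsBackwardSingularPoint u₁ 0 := by
    intro r hr
    rw [hu₁, eLpNorm_top_nsZoom hr₀ z.1 z.2 r 0 u, hst0, hsing (r₀ * r) (mul_pos hr₀ hr),
      ENNReal.mul_top (ENNReal.ofReal_pos.2 hr₀).ne']
  -- ## Step 2: the blow-up sequence
  obtain ⟨v, q, Gz, zs, lam, uh, hlam, hae, hvform, hbox, hballs, hgrads, hIs, hbd1, hvtx, hcontAt,
    hcontOn⟩ := exists_approximants hball1 hwg1 hsing1
  have hI₀top : typeIBound (parabolicCylinder 1 (0 : ℝ × (EuclideanSpace ℝ (Fin 3)))) u₁ p₁ G₁ < ⊤ := by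
    rw [hI1]; exact hI
  -- ## Step 3: the slab limit
  obtain ⟨U, P, H, σ, hσ, hswU, hHU, h4I, hmemU, hconvU⟩ :=
    local_typeI_compactness (typeIBound (parabolicCylinder 1 (0 : ℝ × (EuclideanSpace ℝ (Fin 3)))) u₁ p₁ G₁) v q Gz hI₀top
      hballs hgrads fun m k hmk => hIs m k hmk
  -- shifted subsequences `σ' j = σ (j + m)` stay above the level `m`
  have hσge : ∀ m j, m ≤ σ (j + m) := fun m j => (Nat.le_add_left m j).trans (hσ.id_le (j + m))
  have hlevel : ∀ R : ℝ, ∃ m : ℕ, R ≤ (2 : ℝ) ^ m := fun R => by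
    obtain ⟨m, hm⟩ := pow_unbounded_of_one_lt R (by norm_num : (1 : ℝ) < 2)
    exact ⟨m, hm.le⟩
  have hmeas : ∀ m k : ℕ, m ≤ k → ∀ {R : ℝ}, 0 < R → R ≤ (2 : ℝ) ^ m →
      AEStronglyMeasurable (uncurry (v k)) (volume.restrict (parabolicCylinder R (0 : ℝ × (EuclideanSpace ℝ (Fin 3))))) := by
    intro m k hmk R hR0 hR
    exact (hballs m k hmk).1.distributional.1.aestronglyMeasurable.mono_measure
      (Measure.restrict_mono (parabolicCylinder_mono hR0.le hR _) le_rfl)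
  -- ## Step 4: `‖U‖ ≤ 1` a.e. on the slab, and the truncation
  have hUbd : ∀ R : ℝ, 0 < R → ∀ᵐ w ∂(volume.restrict (parabolicCylinder R (0 : ℝ × (EuclideanSpace ℝ (Fin 3))))),
      ‖uncurry U w‖ ≤ 1 := by
    intro R hR
    obtain ⟨m, hm⟩ := hlevel R
    refine ae_norm_le_of_tendsto_eLpNorm (v := fun j => v (σ (j + m)))
      (fun j => hmeas m _ (hσge m j) hR hm) (hmemU R hR).1
      ((hconvU R hR).comp (tendsto_add_atTop_nat m)) fun j => ?_
    filter_upwards [ae_restrict_mem (isOpen_parabolicCylinder R (0 : ℝ × (EuclideanSpace ℝ (Fin 3)))).measurableSet]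
      with w hw
    refine hbd1 _ w (parabolicCylinder_mono hR.le (hm.trans ?_) _ hw)
    exact pow_le_pow_right₀ (by norm_num) (by linarith [hσge m j])
  have hUbd' : ∀ᵐ w ∂(volume.restrict (Iio (0 : ℝ) ×ˢ (univ : Set (EuclideanSpace ℝ (Fin 3))))), ‖uncurry U w‖ ≤ 1 := by
    refine ae_restrict_of_ae_restrict_of_subset lowerHalf_subset_iUnion ?_
    rw [ae_restrict_iUnion_iff]
    exact fun n => hUbd _ (by positivity)
  classical
  set Ut : ℝ → (EuclideanSpace ℝ (Fin 3)) → (EuclideanSpace ℝ (Fin 3)) := fun t x => if ‖U t x‖ ≤ 1 then U t x else 0 with hUt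
  have hUt_bd : ∀ t x, ‖Ut t x‖ ≤ 1 := fun t x => by
    simp only [hUt]
    split_ifs with h
    · exact h
    · simp
  have hUt_ae : ∀ᵐ w ∂(volume.restrict (Iio (0 : ℝ) ×ˢ (univ : Set (EuclideanSpace ℝ (Fin 3))))), uncurry U w = uncurry Ut w := by
    filter_upwards [hUbd'] with w hw
    rcases w with ⟨t, x⟩
    show U t x = Ut t x
    simp only [hUt, if_pos (show ‖U t x‖ ≤ 1 from hw)]
  have hslab : ((slab (EuclideanSpace ℝ (Fin 3)) (Iio 0) isOpen_Iio : Opens (ℝ × (EuclideanSpace ℝ (Fin 3)))) : Set (ℝ × (EuclideanSpace ℝ (Fin 3)))) =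
      Iio (0 : ℝ) ×ˢ (univ : Set (EuclideanSpace ℝ (Fin 3))) := coe_slab _ _
  have hUt_ae' : ∀ᵐ w ∂(volume.restrict ((slab (EuclideanSpace ℝ (Fin 3)) (Iio 0) isOpen_Iio : Opens (ℝ × (EuclideanSpace ℝ (Fin 3)))) : Set (ℝ × (EuclideanSpace ℝ (Fin 3))))),
      uncurry U w = uncurry Ut w := by rw [hslab]; exact hUt_ae
  have hswUt : IsSuitableWeakSolutionOn (slab (EuclideanSpace ℝ (Fin 3)) (Iio 0) isOpen_Iio) 1 0 Ut P :=
    hswU.congr_ae hUt_ae' (ae_of_all _ fun _ => rfl)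
  have hIUt : typeIBound (Iio (0 : ℝ) ×ˢ univ) Ut P H ≤
      4 * typeIBound (parabolicCylinder 1 (0 : ℝ × (EuclideanSpace ℝ (Fin 3)))) u₁ p₁ G₁ := by
    rw [← typeIBound_congr_ae (p := P) (G := H) hUt_ae]; exact h4I
  have hIUt_top : typeIBound (Iio (0 : ℝ) ×ˢ univ) Ut P H < ⊤ :=
    lt_of_le_of_lt hIUt (ENNReal.mul_lt_top (by norm_num) hI₀top)
  -- ## Step 5: the mild representative
  obtain ⟨V, hVae, hVc, hVmild⟩ := exists_boundedAncientMild_repr hswUt (fun t _ x => hUt_bd t x) hIUt_top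
  have hUV : ∀ᵐ w ∂(volume.restrict (Iio (0 : ℝ) ×ˢ (univ : Set (EuclideanSpace ℝ (Fin 3))))), uncurry U w = uncurry V w := by
    filter_upwards [hUt_ae, hVae] with w h1 h2
    rw [h1, h2]
  have hUV' : ∀ᵐ w ∂(volume.restrict ((slab (EuclideanSpace ℝ (Fin 3)) (Iio 0) isOpen_Iio : Opens (ℝ × (EuclideanSpace ℝ (Fin 3)))) : Set (ℝ × (EuclideanSpace ℝ (Fin 3))))),
      uncurry Ut w = uncurry V w := by rw [hslab]; exact hVae
  refine ⟨V, P, H, fun t ht => ?_, hVmild, hswUt.congr_ae hUV' (ae_of_all _ fun _ => rfl),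
    (hHU.congr_ae hUt_ae').congr_ae hUV', ?_, ?_⟩
  · -- measurable slices (continuity)
    exact (hVc.comp_continuous (f := fun x : (EuclideanSpace ℝ (Fin 3)) => (t, x)) (by fun_prop)
      fun x => ⟨ht, mem_univ _⟩).aestronglyMeasurable
  · -- ## Step 6: non-triviality
    intro hV0
    have hU0 : ∀ᵐ w ∂(volume.restrict (parabolicCylinder 1 (0 : ℝ × (EuclideanSpace ℝ (Fin 3))))), uncurry U w = 0 := by
      refine ae_restrict_of_ae_restrict_of_subset (parabolicCylinder_subset_lowerHalf le_rfl 1) ?_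
      filter_upwards [hUV, hV0] with w h1 h2
      rw [h1, h2]
      rfl
    obtain ⟨m₀, hm₀, hlow⟩ := exists_eLpNorm_lower_bound hI₀top hballs
      (fun m k hmk => hIs m k hmk) hbd1 hvtx hcontAt hcontOn
    have hconv1 := (hconvU 1 one_pos).comp (tendsto_add_atTop_nat 3)
    have hle : ∀ j, m₀ ≤ eLpNorm (uncurry (v (σ (j + 3))) - uncurry U) 3
        (volume.restrict (parabolicCylinder 1 (0 : ℝ × (EuclideanSpace ℝ (Fin 3))))) := by
      intro j
      have hk : 3 ≤ σ (j + 3) := hσge 3 j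
      refine (hlow _ hk).trans (le_of_eq (eLpNorm_congr_ae ?_))
      filter_upwards [hU0] with w hw
      rw [Pi.sub_apply, hw, sub_zero]
    have : m₀ ≤ 0 := ge_of_tendsto' hconv1 hle
    exact hm₀.ne' (le_antisymm this bot_le)
  · -- `𝐈 < ⊤`
    rw [← typeIBound_congr_ae (p := P) (G := H) hVae]
    exact hIUt_top

/-- **Albritton–Barker 2019, Thm. 1.1, forward direction, DISCHARGED** — the named fact
`AlbrittonBarkerForward` (`LocalTypeICharacterization.lean`: a suitable weak solution with a Type I singular point,
`LocalTypeISingularityExists`, yields a non-trivial mild bounded ancient solution with `𝐈 < ∞`,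
`NontrivialMildAncientTypeIExists`) holds, by repackaging
`LocalTypeIBlowup.exists_ancientMild_of_localTypeISingularPoint` (Seregin–Šverák's blow-up procedure at a clean backward-singular
vertex: files `LocalTypeIBlowup/{Vertex, PointPicking, Approximants, CompactnessLevels, Compactness, Normalization,
Engine, Limits, Mild, Nontrivial}`).  Literature twin of the Summits-side
`Summit.NavierStokesRegularity.NavierStokesRegularity.Theorems.albrittonBarkerForward_proof`.
[cite: AlbrittonBarker2019, Thm 1.1 (forward direction) and §3; SereginSverak2009, Thm 2.8] -/
theorem AlbrittonBarkerForward_holds : AlbrittonBarkerForward := by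
  rintro ⟨r₀, z, u, p, hloc⟩
  obtain ⟨V, P, H, -, h2, h3, h4, h5, h6⟩ := exists_ancientMild_of_localTypeISingularPoint hloc
  exact ⟨V, P, H, h2, h3, h4, h5, h6⟩

/-- **Albritton–Barker 2019, Theorem 1.1, DISCHARGED** — the named fact `AlbrittonBarkerTypeICharacterization`
(`LocalTypeI.lean`: "The following are equivalent: • There exists a suitable weak solution with Type I singular
point. • There exists a non-trivial mild bounded ancient solution with `𝐈 < ∞`.", corrected rendering
`LocalTypeISingularityExists ↔ NontrivialMildAncientTypeIExists`) holds: the accepted reduction to the forward half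
`AlbrittonBarkerTypeICharacterization_of_forward` (`LocalTypeICharacterizationHolds.lean`, with Lemma 2.2
`SuitableCompactness_holds` and Prop. 2.3 `PersistenceOfSingularities_holds` feeding the reverse half
`localTypeISingularityExists_of_nontrivialMildAncientTypeIExists`) applied to `AlbrittonBarkerForward_holds` — the
one-line composite that module's docstring defers "until the named fact `AlbrittonBarkerForward` is discharged".
[cite: AlbrittonBarker2019, Thm 1.1] -/
theorem AlbrittonBarkerTypeICharacterization_holds : AlbrittonBarkerTypeICharacterization :=
  AlbrittonBarkerTypeICharacterization_of_forward AlbrittonBarkerForward_holds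

end Literature.Analysis.FluidPDE

end
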